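import Summits.HodgeConjecture.HodgeConjecture.Theses.VHCAbelianSchemesRoad
import Summits.HodgeConjecture.CorCM.AndrePolarizedFormHolds
import Literature.AlgebraicGeometry.HodgeTheory.KodairaEmbeddingHyperplaneClass
import Literature.AlgebraicGeometry.Andre1996.WeilClassesAlgebraicallyAnchoredPencil
import Literature.AlgebraicGeometry.Andre1996.SplitWeilClassesWeilTensorPencil
import Literature.AlgebraicGeometry.Andre1996.CMHodgeClassesEllipticPowerPencils
import Literature.AlgebraicGeometry.Deligne1982.SplitWeilTypeCMIsometry
import Literature.AlgebraicGeometry.Motives.AimedSplitProductProofs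
import HarnessLib

/-!
# Road b02 (`VHCAbelianSchemesRoad`), binder #22 `AndreAnchoredPencilsAlgebraic`: Lemme 6.3.2 DISCHARGED by the tree's
# kernel proof of André 1992 — #22 reduced to Lemme 6.3.3 ALONE (modulo Kodaira's embedding theorem)

research route conditional on HC_CM; not a corollary; Q11.4-sentence-2 already refuted in dim ≥ 3. Seat
`pub-hodge-ring2-andre-pencil-p1` (prover, first lane on item stmt-HodgeConjecture-19784), cell `pub-hodge-ring2`.

The route binder `VHCAbelianSchemesRoad.AndreAnchoredPencilsAlgebraic` (#22, rank 7; «REFEREED NAMED FACT, never staffed»)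
is the Literature fact `Andre1996.andre1996_cmHodgeClasses_algebraicallyAnchoredPencils` — André 1996 Lemmes 6.3.2 AND
6.3.3 COMBINED: every Hodge class of codimension `p > 1` on a complex abelian variety OF CM TYPE lies in the span of
pull-backs `g^*(w)` of classes `w` carried by ALGEBRAICALLY ANCHORED compact pencils (`IsAlgebraicallyAnchoredPencilFor`).
Its filed risk («why it might fail: only by mis-rendering — if the Lean fact silently packaged HC_CM it would be stronger
than print») asks exactly which printed inputs the combined fact carries. This file answers in kernel form:

* Lemme 6.3.2 (= André 1992: Hodge classes on a CM abelian variety are sums of pull-backs along homomorphisms of Weil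
  classes of abelian varieties of SPLIT Weil type relative to one CM field, WITH a polarization — Deligne's Thm. 4.8
  (a)+(b)) is a THEOREM OF THE TREE, hypothesis-free:
  `Summit.HodgeConjecture.CorCM.AndreSplit.andre1992_hodgeClasses_cmType_mem_span_pullback_polarizedHyperbolicWeilClassesCM_holds`
  (cell COR-CM, targets `HodgeTheory.IsPolarizedHyperbolicWeilTypeCM` = Weil type relative to `E ≅ ℚ[T]/(R(T²))` + ONE
  rational class with a KÄHLER real multiple, Rosati-compatible, of split discriminant, hyperbolic).
* Lemme 6.3.3 ALONE is the literature seat's named fact `Andre1996.andre1996_splitWeilClasses_algebraicallyAnchoredPencil`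
  (split `E`-Weil data, NO CM hypothesis, polarization carried by a HYPERPLANE CLASS `e^* a` of a projective embedding).
* The two meet up to ONE conversion between the tree's two typings of «polarization»: Kähler-multiple rational class
  (CorCM) versus hyperplane class of an embedding (the 6.3.3 facts). Hyperplane ⟹ Kähler-multiple is the tree's
  `Deligne1982.exists_isKaehlerClass_smul_map_ι` (§1, `isPolarizedHyperbolicWeilTypeCM_of_hyperplaneClass`); the converse
  is KODAIRA'S EMBEDDING THEOREM, entering BY NAME as the Literature fact
  `HodgeTheory.Kodaira1954_rationalKaehlerClass_eq_hyperplaneClass` (statement-only file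
  `HodgeTheory/KodairaEmbeddingHyperplaneClass`; Huybrechts Prop. 5.3.1 / Cor. 5.3.3, Voisin I Thm. 7.10–7.11).

## Content (theorems only; 0 `def`, 0 `sorry`; standard axioms)

* §1 `exists_hyperplaneClass_of_isPolarizedHyperbolicWeilTypeCM` — Kodaira ⟹ every polarized hyperbolic split Weil-type
  CM-field datum carries the hyperplane-class data `(e, a)` the 6.3.3 facts quantify over (Rosati-compatible, hyperbolic);
  `isPolarizedHyperbolicWeilTypeCM_of_hyperplaneClass` — the converse, Kodaira-free.
* §2 **`andre1996_cmHodgeClasses_algebraicallyAnchoredPencils_of_kodaira_of_splitWeilPencil`**: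
  Kodaira ∧ Lemme 6.3.3 alone ⟹ #22 (André 1992 = Lemme 6.3.2 supplied by the CorCM kernel theorem);
  `andre1996_cmHodgeClasses_weilTensorPencils_of_kodaira_of_splitWeilTensorPencil` — the same for the TENSOR-POINT
  renderings (lit seat's `andre1996_splitWeilClasses_weilTensorPencil` ⟹ lane ab-andre-2's combined fact
  `andre1996_cmHodgeClasses_weilTensorPencils`), hence `…_ellipticPowerPencils_…` and #22 again.
* §3 BY NAME on the route decl: **`AndreAnchoredPencilsAlgebraic_of_kodaira_of_splitWeilPencil`** (and the tensor twin):
  `Kodaira1954_rationalKaehlerClass_eq_hyperplaneClass → andre1996_splitWeilClasses_algebraicallyAnchoredPencil →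
  VHCAbelianSchemesRoad.AndreAnchoredPencilsAlgebraic`.
* §4 Rows: the route's `closes` with `h₂₂` replaced by (Kodaira, 6.3.3-alone) — `hodgeAbelianVarieties_of_closes_of_kodaira_of_splitWeilPencil`;
  and `HC_CM` from Kodaira ∧ 6.3.3-alone ∧ transport of algebraicity on COMPACT abelian pencils
  (`cmAbelianHodge_of_kodaira_of_splitWeilPencil_of_compactPencilVHC`; André's Remarque 2 with the 6.3.2 half discharged).
  `cmAbelianHodge_iff_hyperplaneSplitWeilClassesCM_of_kodaira` — CorCM's kernel equivalence «`HC_CM` ⟺ the Weil classes at the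
  polarized hyperbolic split CM points are algebraic» moved into the HYPERPLANE vocabulary of the Weil ladder (granted Kodaira).

HONEST STATUS. Nothing here proves #22, Lemme 6.3.3, Kodaira's theorem, `HC_CM`, `HC_AV` or any case of the Hodge
conjecture: every row is an implication whose named inputs are displayed. What is NEW is bookkeeping with teeth: the
road's binder #22 now COSTS exactly «Lemme 6.3.3 alone (refereed, [Andre1996Motifs] p. 33) + Kodaira (textbook)», the
6.3.2 half being kernel-certified; in particular #22 packages no `HC_CM` beyond what Lemme 6.3.3 itself asserts (its
special fibre is algebraic by Tate–Murasaki in print). Item stmt-HodgeConjecture-19784 stays OPEN (conditional result);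
its planner may re-type the binder as the pair (6.3.3-alone, Kodaira) — not this seat's edit (D-0014).
References: [cite: Andre1996Motifs, §6.3 Lemme 6.3.2 (p. 32), Lemme 6.3.3 and proof (p. 33), Remarque 2]
[cite: Andre1992HodgeCM, Théorème] [cite: Milne2020HodgeClassesAV, §2 2.1–2.2, §3 Thm. 1] [cite: Deligne1982HodgeCycles, §4 Cor. 4.2, Lemma 4.6, Thm. 4.8]
[cite: Huybrechts2005, Prop. 5.3.1, Cor. 5.3.3] [cite: VoisinHodgeI2002, Thm. 7.10, Thm. 7.11, §3.3.2].
-/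

noncomputable section

open CategoryTheory

namespace Summit.HodgeConjecture.HodgeConjecture.Theorems

-- the cell's namespace repeats the summit name (`Summit.HodgeConjecture.HodgeConjecture…`), as in every road file
set_option linter.dupNamespace false

open Literature.AlgebraicGeometry Literature.AlgebraicGeometry.Motives
open Literature.AlgebraicGeometry.HodgeTheory
open Literature.AlgebraicTopology.SingularHomology
open Literature.AlgebraicGeometry.Deligne1982 (IsWeilTypeCM exists_isKaehlerClass_smul_map_ι)
open Literature.AlgebraicGeometry.VanGeemen1994 (pullbackOne)
open Literature.AlgebraicGeometry.Abdulali1994 (InvariantCyclesHoldFor)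
open Literature.AlgebraicGeometry.Milne1999 (IsOfCMType CMHodgeHypothesisAt)
open Literature.AlgebraicGeometry.Andre1996 (andre1996_cmHodgeClasses_algebraicallyAnchoredPencils
  andre1996_splitWeilClasses_algebraicallyAnchoredPencil andre1996_splitWeilClasses_weilTensorPencil
  andre1996_cmHodgeClasses_weilTensorPencils andre1996_cmHodgeClasses_ellipticPowerPencils
  IsAlgebraicallyAnchoredPencilFor IsWeilTensorAnchoredPencilFor cmHodgeHypothesisAt_of_algebraicallyAnchoredPencils)
open Summit.HodgeConjecture.CorCM.AndreSplit
  (andre1992_hodgeClasses_cmType_mem_span_pullback_polarizedHyperbolicWeilClassesCM_holds)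

/-! ## §1 The two typings of «polarization» on a split Weil-type CM-field datum, compared -/

/-- **Kodaira ⟹ hyperplane-class data for Deligne's Thm. 4.8 (a)+(b).** Granted Kodaira's embedding theorem (named fact
`Kodaira1954_rationalKaehlerClass_eq_hyperplaneClass`), a complex abelian variety of Weil type relative to the CM field
`E = ℚ(η) ≅ ℚ[T]/(R(T²))`, of `E`-rank `2k`, satisfying `IsPolarizedHyperbolicWeilTypeCM B η R e₀ k` (one rational class `h`
with a Kähler real multiple, Rosati-compatible with `η`, hyperbolic) carries a projective embedding `e : B ↪ ℙʳ` and a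
non-zero rational `a ∈ H²(ℙʳ(ℂ); ℂ)` whose hyperplane class `e^* a` (`= h`) is Rosati-compatible
(`Q_{e^*a}(η^* x, y) = -Q_{e^*a}(x, η^* y)`) and SPLIT (`Motives.IsHyperbolicWeilType B η (k·e₀) (e^* a)`: André's
condition `(*)`) — the hypothesis format of the tree's Lemme 6.3.3 facts. (`dim B = 2ke₀ ≥ 2`, `IsWeilTypeCM.two_le_dim`.)
[cite: Deligne1982HodgeCycles, §4 Thm. 4.8 (a)–(b), Cor. 4.2] [cite: VoisinHodgeI2002, Thm. 7.11] [cite: Huybrechts2005, Prop. 5.3.1, Cor. 5.3.3] -/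
theorem exists_hyperplaneClass_of_isPolarizedHyperbolicWeilTypeCM
    (hK : Kodaira1954_rationalKaehlerClass_eq_hyperplaneClass)
    {B : AbelianVariety ℂ} {η : B ⟶ B} {R : Polynomial ℤ} {e₀ k : ℕ}
    (hP : IsPolarizedHyperbolicWeilTypeCM B η R e₀ k) :
    ∃ (e : ProjectiveEmbedding B.X) (a : complexBetti (projectiveSpace e.n ℂ) 2),
      IsRationalClass a ∧ a ≠ 0 ∧
      (∀ x y : complexBetti B.X 1,
        polarizationPairingOne B.X (complexBetti.map e.ι 2 a) (B.dim - 1) (pullbackOne B η x) y =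
          -polarizationPairingOne B.X (complexBetti.map e.ι 2 a) (B.dim - 1) x (pullbackOne B η y)) ∧
      IsHyperbolicWeilType B η (k * e₀) (complexBetti.map e.ι 2 a) := by
  obtain ⟨hW, h, hpol, hKm, hros, -, hhyp⟩ := hP
  have hd : 0 < B.dim := by have := hW.two_le_dim; omega
  obtain ⟨e, a, ha, ha0, hea⟩ :=
    hK (AbelianVariety.isSmoothProjective_holds (A := B)) hd h hpol.isRationalClass hKm
  refine ⟨e, a, ha, ha0, ?_, ?_⟩
  · rw [hea]; exact hros
  · rw [hea]; exact hhyp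

/-- **The converse, Kodaira-free: hyperplane-class data give Deligne's Thm. 4.8 (a)+(b).** For `(B, η)` of Weil type
relative to `E` with `E`-rank `2k`, a projective embedding `e`, a non-zero rational `a` with `e^* a` Rosati-compatible and
split, `IsPolarizedHyperbolicWeilTypeCM B η R e₀ k` holds — `e^* a` has a Kähler real multiple (restricted Fubini–Study,
`Deligne1982.exists_isKaehlerClass_smul_map_ι`), and `IsPolarizedHyperbolicWeilTypeCM.of_kaehler` supplies the
polarization-class and discriminant clauses (Lefschetz `(1,1)`, hard Lefschetz, Landherr). So the two typings of André's
`(*)` / Deligne's (a)+(b) in the tree differ EXACTLY by Kodaira's theorem. [cite: Deligne1982HodgeCycles, §4 Thm. 4.8 (a)–(b), Cor. 4.2, Lemma 4.6]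
[cite: VoisinHodgeI2002, §3.3.2 and Thm. 6.25] [cite: Andre1996Motifs, §6.3 b) condition (*) (p. 32)] -/
theorem isPolarizedHyperbolicWeilTypeCM_of_hyperplaneClass
    {B : AbelianVariety ℂ} {η : B ⟶ B} {R : Polynomial ℤ} {e₀ k : ℕ}
    (hW : IsWeilTypeCM B η R e₀ k) (e : ProjectiveEmbedding B.X) {a : complexBetti (projectiveSpace e.n ℂ) 2}
    (ha : IsRationalClass a) (ha0 : a ≠ 0)
    (hros : ∀ x y : complexBetti B.X 1,
      polarizationPairingOne B.X (complexBetti.map e.ι 2 a) (B.dim - 1) (pullbackOne B η x) y =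
        -polarizationPairingOne B.X (complexBetti.map e.ι 2 a) (B.dim - 1) x (pullbackOne B η y))
    (hhyp : IsHyperbolicWeilType B η (k * e₀) (complexBetti.map e.ι 2 a)) :
    IsPolarizedHyperbolicWeilTypeCM B η R e₀ k := by
  have hB : B.dim = B.dim - 1 + 1 := by have := hW.two_le_dim; omega
  have hKm : ∃ s : ℝ, s ≠ 0 ∧ IsKaehlerClass B.dim B.X ((s : ℂ) • complexBetti.map e.ι 2 a) := by
    rw [hB]
    exact exists_isKaehlerClass_smul_map_ι (Motives.isSmoothProjective_of_dim_eq' hB) e ha ha0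
  exact IsPolarizedHyperbolicWeilTypeCM.of_kaehler hW (ha.pullback _) hKm hros hhyp

/-! ## §2 Lemme 6.3.2 discharged: #22 from Lemme 6.3.3 alone (modulo Kodaira) -/

/-- **#22 ⟸ Kodaira ∧ Lemme 6.3.3 alone — André 1992 (Lemme 6.3.2) supplied by the tree's kernel theorem.** Granted
Kodaira's embedding theorem and the literature seat's named fact for Lemme 6.3.3 ALONE
(`andre1996_splitWeilClasses_algebraicallyAnchoredPencil`: split `E`-Weil data with hyperplane-class polarization, no CM
hypothesis ⟹ an algebraically anchored compact pencil), the COMBINED fact #22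
(`andre1996_cmHodgeClasses_algebraicallyAnchoredPencils`) follows: for `B` of CM type and a rational `(p,p)` class `c`,
`p > 1`, CorCM's `andre1992_hodgeClasses_cmType_mem_span_pullback_polarizedHyperbolicWeilClassesCM_holds` writes `c` in the
span of pull-backs `g^*(w)` along homomorphisms `g : B ⟶ B'` of rational `(p,p)` Weil classes `w ∈ W_E(B') ⊗ ℂ` on CM
abelian varieties `B'` satisfying Deligne's Thm. 4.8 (a)+(b) relative to one Galois CM field; §1 converts the polarization
into a hyperplane class; Lemme 6.3.3 anchors each `(B', w)` (relative dimension `dim B'`); the span is monotone.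
[cite: Andre1996Motifs, §6.3 Lemme 6.3.2 (p. 32) and Lemme 6.3.3 (p. 33)] [cite: Andre1992HodgeCM, Théorème]
[cite: Milne2020HodgeClassesAV, §3 Thm. 1] [cite: Huybrechts2005, Prop. 5.3.1, Cor. 5.3.3] -/
theorem andre1996_cmHodgeClasses_algebraicallyAnchoredPencils_of_kodaira_of_splitWeilPencil
    (hK : Kodaira1954_rationalKaehlerClass_eq_hyperplaneClass)
    (h633 : andre1996_splitWeilClasses_algebraicallyAnchoredPencil) :
    andre1996_cmHodgeClasses_algebraicallyAnchoredPencils := by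
  intro B _ hCM p hp c hc hpp
  obtain ⟨R, e₀, -, hspan⟩ :=
    andre1992_hodgeClasses_cmType_mem_span_pullback_polarizedHyperbolicWeilClassesCM_holds B hCM
  refine Submodule.span_mono ?_ (hspan p (by omega) c hc hpp)
  rintro _ ⟨B', g, η, w, -, hP, hw, hwQ, -, rfl⟩
  obtain ⟨e, a, ha, ha0, hros, hhyp⟩ := exists_hyperplaneClass_of_isPolarizedHyperbolicWeilTypeCM hK hP
  obtain ⟨𝒳, S, f, hf⟩ := h633.single hP.isWeilTypeCM hp ha ha0 hros hhyp hw hwQ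
  exact ⟨B', g, w, B'.dim, 𝒳, S, f, hf, rfl⟩

/-- **The tensor-point renderings: lane ab-andre-2's combined fact from the literature seat's 6.3.3-alone fact.** Granted
Kodaira and `andre1996_splitWeilClasses_weilTensorPencil` (Lemme 6.3.3 ALONE, split `E`-Weil data, hyperplane-class
polarization, WITH the special fibre recorded as an `E`-tensor point over a PRESCRIBED elliptic curve `E₀`), the combined
fact `andre1996_cmHodgeClasses_weilTensorPencils` (Lemmes 6.3.2 + 6.3.3 for `B` of CM type, same clause) follows — again
André 1992 from the CorCM kernel theorem, the polarization converted by §1, `n = 1` in the fact.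
[cite: Andre1996Motifs, §6.3 Lemme 6.3.2 (p. 32), Lemme 6.3.3 (i)–(iii) and proof (p. 33)] [cite: Andre1992HodgeCM, Théorème]
[cite: Milne2020HodgeClassesAV, §3 Thm. 1] -/
theorem andre1996_cmHodgeClasses_weilTensorPencils_of_kodaira_of_splitWeilTensorPencil
    (hK : Kodaira1954_rationalKaehlerClass_eq_hyperplaneClass)
    (h633 : andre1996_splitWeilClasses_weilTensorPencil) :
    andre1996_cmHodgeClasses_weilTensorPencils := by
  intro E₀ hE₀ B _ hCM p hp c hc hpp
  obtain ⟨R, e₀, -, hspan⟩ :=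
    andre1992_hodgeClasses_cmType_mem_span_pullback_polarizedHyperbolicWeilClassesCM_holds B hCM
  refine Submodule.span_mono ?_ (hspan p (by omega) c hc hpp)
  rintro _ ⟨B', g, η, w, -, hP, hw, hwQ, -, rfl⟩
  obtain ⟨e, a, ha, ha0, hros, hhyp⟩ := exists_hyperplaneClass_of_isPolarizedHyperbolicWeilTypeCM hK hP
  obtain ⟨𝒳, S, f, hf⟩ := h633 E₀ hE₀ R e₀ p hp 1 (fun _ => B') (fun _ => η) (fun _ => e) (fun _ => a)
    (fun _ => w) (fun _ => hP.isWeilTypeCM) (fun _ => ⟨ha, ha0⟩) (fun _ => hros) (fun _ => hhyp) (fun _ => hw)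
    (fun _ => hwQ)
  exact ⟨B', g, w, B'.dim, 𝒳, S, f, hf 0, rfl⟩

/-- … hence lane ab-andre-2's elliptic-power combined fact `andre1996_cmHodgeClasses_ellipticPowerPencils` (instantiate at the
Weierstrass curve of `ℤ + iℤ`, `HodgeTheory.exists_abelianVariety_dim_one_cupProduct_ne_zero`, and forget the Weil structure
of the special fibre) … [cite: Andre1996Motifs, Lemme 6.3.3 (ii) (p. 33)] -/
theorem andre1996_cmHodgeClasses_ellipticPowerPencils_of_kodaira_of_splitWeilTensorPencil
    (hK : Kodaira1954_rationalKaehlerClass_eq_hyperplaneClass)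
    (h633 : andre1996_splitWeilClasses_weilTensorPencil) :
    andre1996_cmHodgeClasses_ellipticPowerPencils := by
  intro B hB hCM p hp c hc hpp
  obtain ⟨E₀, hE₀, -⟩ := exists_abelianVariety_dim_one_cupProduct_ne_zero
  refine Submodule.span_mono ?_
    (andre1996_cmHodgeClasses_weilTensorPencils_of_kodaira_of_splitWeilTensorPencil hK h633 E₀ hE₀ B hB hCM p hp c
      hc hpp)
  rintro c' ⟨B', g, w, d, 𝒳, S, f, ⟨hf, s₁, s₀, W, A₁, e₁, g', q, hW, hq, hgw, halg, A₀, e₀, N, ψ₀, hiso, -⟩, rfl⟩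
  exact ⟨B', g, w, d, 𝒳, S, f, ⟨hf, s₁, s₀, W, A₁, e₁, g', q, hW, hq, hgw, halg⟩, ⟨s₀, A₀, E₀, N, hE₀, hiso, ⟨e₀⟩⟩,
    rfl⟩

/-- … and #22 a second time, through the tensor-point fact (forget clause (ii)). [cite: Andre1996Motifs, Lemmes 6.3.2–6.3.3 (pp. 32–33)] -/
theorem andre1996_cmHodgeClasses_algebraicallyAnchoredPencils_of_kodaira_of_splitWeilTensorPencil
    (hK : Kodaira1954_rationalKaehlerClass_eq_hyperplaneClass)
    (h633 : andre1996_splitWeilClasses_weilTensorPencil) :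
    andre1996_cmHodgeClasses_algebraicallyAnchoredPencils := by
  intro B hB hCM p hp c hc hpp
  refine Submodule.span_mono ?_
    (andre1996_cmHodgeClasses_ellipticPowerPencils_of_kodaira_of_splitWeilTensorPencil hK h633 B hB hCM p hp c hc hpp)
  rintro c' ⟨B', g, w, d, 𝒳, S, f, hf, -, rfl⟩
  exact ⟨B', g, w, d, 𝒳, S, f, hf, rfl⟩

/-! ## §3 The route binder BY NAME -/

/-- **`VHCAbelianSchemesRoad.AndreAnchoredPencilsAlgebraic` (item stmt-HodgeConjecture-19784) from Kodaira's embedding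
theorem and Lemme 6.3.3 ALONE** — CONDITIONAL (two named facts displayed as hypotheses; the item stays open): the binder
is by definition #22, and §2 applies. [cite: Andre1996Motifs, §6.3 Lemmes 6.3.2–6.3.3 (pp. 32–33)]
[cite: Andre1992HodgeCM, Théorème] [cite: Huybrechts2005, Prop. 5.3.1, Cor. 5.3.3] -/
theorem AndreAnchoredPencilsAlgebraic_of_kodaira_of_splitWeilPencil
    (hK : Kodaira1954_rationalKaehlerClass_eq_hyperplaneClass)
    (h633 : andre1996_splitWeilClasses_algebraicallyAnchoredPencil) :
    Summit.HodgeConjecture.HodgeConjecture.Theses.VHCAbelianSchemesRoad.AndreAnchoredPencilsAlgebraic := by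
  unfold Summit.HodgeConjecture.HodgeConjecture.Theses.VHCAbelianSchemesRoad.AndreAnchoredPencilsAlgebraic
  exact andre1996_cmHodgeClasses_algebraicallyAnchoredPencils_of_kodaira_of_splitWeilPencil hK h633

/-- The same through the TENSOR-POINT fact (`andre1996_splitWeilClasses_weilTensorPencil`).
[cite: Andre1996Motifs, §6.3 Lemmes 6.3.2–6.3.3 (pp. 32–33)] [cite: Andre1992HodgeCM, Théorème] -/
theorem AndreAnchoredPencilsAlgebraic_of_kodaira_of_splitWeilTensorPencil
    (hK : Kodaira1954_rationalKaehlerClass_eq_hyperplaneClass)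
    (h633 : andre1996_splitWeilClasses_weilTensorPencil) :
    Summit.HodgeConjecture.HodgeConjecture.Theses.VHCAbelianSchemesRoad.AndreAnchoredPencilsAlgebraic := by
  unfold Summit.HodgeConjecture.HodgeConjecture.Theses.VHCAbelianSchemesRoad.AndreAnchoredPencilsAlgebraic
  exact andre1996_cmHodgeClasses_algebraicallyAnchoredPencils_of_kodaira_of_splitWeilTensorPencil hK h633

/-! ## §4 Rows on the road and on the compact-pencil axis -/

/-- **The route's deciding chain with binder #22 replaced by (Kodaira, Lemme 6.3.3 alone).** `HC_AV` (the leaf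
`PadicSemiregularLift.HodgeAbelianVarieties`) from the route's `closes` — K-C, K-SR♭∃ on the diagonal, the twisted door,
Raynaud, Lemme 6.3.1 — with `h₂₂` supplied by §3. Every hypothesis displayed; nothing is proved about any of them.
[cite: Andre1996Motifs, §6.3 (pp. 31–33)] [cite: BuchweitzFlenner2003, §5 Thm. 5.1] -/
theorem hodgeAbelianVarieties_of_closes_of_kodaira_of_splitWeilPencil
    (hC : Theses.VHCAbelianSchemesRoad.ChernCharacterOnBetti)
    (hDiag : Theses.VHCAbelianSchemesRoad.SemiregularSheafRepresentativesTwAtDiag)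
    (hDoor : Theses.VHCAbelianSchemesRoad.TwistedPerfectDoor) (hR : Theses.VHCAbelianSchemesRoad.RaynaudSectionProjective)
    (h₂₁ : Theses.VHCAbelianSchemesRoad.AndreCMAnchoredPencil)
    (hK : Kodaira1954_rationalKaehlerClass_eq_hyperplaneClass)
    (h633 : andre1996_splitWeilClasses_algebraicallyAnchoredPencil) :
    Summit.HodgeConjecture.HodgeConjecture.Theses.PadicSemiregularLift.HodgeAbelianVarieties :=
  -- route rev 21/22 (2026-08-27, R9.4–R9.8) re-keyed `closes` to the primed binders; the same chain is obtained from the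
  -- admissibility-generic kernel of `Theorems/VHCAbelianSchemesRoadDiagonal` at `AdmTw` (`bfSingleAdmissible` = right disjunct).
  Summit.HodgeConjecture.HodgeConjecture.Ring2.SemiregularRepresentatives.hc_av_of_exceptionalRegimeAt_twisted_diagonal_two hC
    (fun _ _ _ _ h => Or.inr h) hDiag hDoor hR h₂₁ (AndreAnchoredPencilsAlgebraic_of_kodaira_of_splitWeilPencil hK h633)

/-- **`HC_CM` on the compact-pencil axis with the 6.3.2 half discharged** (André's Remarque 2 / Milne Rem. 2–3, step
b)–c)): Kodaira ∧ Lemme 6.3.3 alone ∧ transport of algebraicity (`Abdulali1994.InvariantCyclesHoldFor`) on EVERY compact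
pencil of abelian varieties ⟹ the Hodge conjecture for every complex abelian variety of CM type, as the summit's item
`RankFourFaces.CMAbelianHodge` (`= ∀ B, Milne1999.CMHodgeHypothesisAt B`, `CorCM.hc_cm_iff_forall_cmHodgeHypothesisAt`);
`HC_CM` is a CONCLUSION here — the compact-pencil input is the open, load-bearing hypothesis (it is itself a case of
`HC_AV`, `Andre1996.invariantCyclesHoldFor_compactPencil_of_hodgeConjecture_abelian`).
[cite: Andre1996Motifs, §6.3 b)–c) and Remarque 2 (pp. 32–33)] [cite: Milne2020HodgeClassesAV, Rem. 2–3] [cite: Milne1999, §7 p. 72] -/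
theorem cmAbelianHodge_of_kodaira_of_splitWeilPencil_of_compactPencilVHC
    (hK : Kodaira1954_rationalKaehlerClass_eq_hyperplaneClass)
    (h633 : andre1996_splitWeilClasses_algebraicallyAnchoredPencil)
    (hV : ∀ ⦃d : ℕ⦄ ⦃𝒳 S : SchemeOver ℂ⦄ (f : 𝒳 ⟶ S), IsCompactAbelianPencil f d → InvariantCyclesHoldFor f d) :
    Summit.HodgeConjecture.HodgeConjecture.Theses.RankFourFaces.CMAbelianHodge :=
  Summit.HodgeConjecture.CorCM.hc_cm_iff_forall_cmHodgeHypothesisAt.mpr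
    (cmHodgeHypothesisAt_of_algebraicallyAnchoredPencils
      (andre1996_cmHodgeClasses_algebraicallyAnchoredPencils_of_kodaira_of_splitWeilPencil hK h633) hV)

/-- **André's reduction of `HC_CM`, in the HYPERPLANE vocabulary of the Weil ladder.** Granted Kodaira's embedding theorem,
`HC_CM` (`RankFourFaces.CMAbelianHodge`) is EQUIVALENT to: for every Galois CM field `E ≅ ℚ[T]/(R(T²))` and every complex
abelian variety `B` OF CM TYPE of Weil type relative to `E` with `E`-rank `2p`, carrying a projective embedding `e` and a
non-zero rational `a` whose hyperplane class `e^* a` is Rosati-compatible and split (André's `(*)`), every rational `(p,p)`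
class of `W_E(B) ⊗ ℂ` is algebraic. This is CorCM's kernel equivalence `hc_cm_iff_polarizedHyperbolicWeilClassesCM`
(targets `IsPolarizedHyperbolicWeilTypeCM`) moved across §1: (⟹) Kodaira-free (`isPolarizedHyperbolicWeilTypeCM_of_hyperplaneClass`),
(⟸) by `exists_hyperplaneClass_of_isPolarizedHyperbolicWeilTypeCM`. No case of the Hodge conjecture is proved here.
[cite: Andre1992HodgeCM, Théorème] [cite: Milne2020HodgeClassesAV, §3 Thm. 1] [cite: Deligne1982HodgeCycles, §4 Thm. 4.8]
[cite: Markman2025SurveySecant, §1.1 (before Thm. 1.4)] [cite: Huybrechts2005, Prop. 5.3.1, Cor. 5.3.3] -/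
theorem cmAbelianHodge_iff_hyperplaneSplitWeilClassesCM_of_kodaira
    (hK : Kodaira1954_rationalKaehlerClass_eq_hyperplaneClass) :
    Summit.HodgeConjecture.HodgeConjecture.Theses.RankFourFaces.CMAbelianHodge ↔
      ∀ (R : Polynomial ℤ) (e₀ : ℕ), IsGaloisCMFieldPoly (R.comp (Polynomial.X ^ 2)) (2 * e₀) →
        ∀ (B : AbelianVariety ℂ) (η : B ⟶ B) (p : ℕ), IsOfCMType B → IsWeilTypeCM B η R e₀ p →
          ∀ (e : ProjectiveEmbedding B.X) (a : complexBetti (projectiveSpace e.n ℂ) 2),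
            IsRationalClass a → a ≠ 0 →
            (∀ x y : complexBetti B.X 1,
              polarizationPairingOne B.X (complexBetti.map e.ι 2 a) (B.dim - 1) (pullbackOne B η x) y =
                -polarizationPairingOne B.X (complexBetti.map e.ι 2 a) (B.dim - 1) x (pullbackOne B η y)) →
            IsHyperbolicWeilType B η (p * e₀) (complexBetti.map e.ι 2 a) →
              ∀ w ∈ weilClassesField B η (R.comp (Polynomial.X ^ 2)) (2 * p), IsRationalClass w →
                IsOfHodgeType B.dim B.X (2 * p) p p w → w ∈ algebraicClasses B.X p := by
  refine Summit.HodgeConjecture.CorCM.AndreSplit.hc_cm_iff_polarizedHyperbolicWeilClassesCM.trans ⟨?_, ?_⟩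
  · intro h R e₀ hR B η p hCM hW e a ha ha0 hros hhyp
    exact h R e₀ hR B η p hCM (isPolarizedHyperbolicWeilTypeCM_of_hyperplaneClass hW e ha ha0 hros hhyp)
  · intro h R e₀ hR B η p hCM hP
    obtain ⟨e, a, ha, ha0, hros, hhyp⟩ := exists_hyperplaneClass_of_isPolarizedHyperbolicWeilTypeCM hK hP
    exact h R e₀ hR B η p hCM hP.isWeilTypeCM e a ha ha0 hros hhyp

end Summit.HodgeConjecture.HodgeConjecture.Theorems

end
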